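import Mathlib
import Literature.NumberTheory.Automorphic.GaloisActionPlaces
import HarnessLib

/-!
# Galois-conjugate prime ideals of a ring of integers: `σ` fixes `(p)`, unramifiedness of `(p)` at `σ𝔭`, comaximal distinct primes,
# and the norm-product membership `n ∈ 𝔠 · 𝔭_w · 𝔭_{σw}`

Topic `Literature/NumberTheory/NumberFields`, namespace `Literature.NumberTheory.NumberFields`.  THEOREMS ONLY (no `def`, no instance,
no named fact, no notation), Mathlib + ★ `Automorphic/GaloisActionPlaces` (the action `g • w` of a group of ring automorphisms on
`HeightOneSpectrum B`, `instMulActionHeightOneSpectrum`, and `HeightOneSpectrum.smul_asIdeal_pow_dvd_smul_iff`: `𝔭_{g w}ⁿ ∣ g • I ↔ 𝔭_wⁿ ∣ I`).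

## Source and what is recorded

J. Neukirch, *Algebraic Number Theory* (1999) [NeukirchANT1999], Ch. I §3 ((3.6), the Chinese remainder theorem for pairwise coprime
ideals of a Dedekind domain — distinct nonzero primes are comaximal) and Ch. I §9 (conjugate prime ideals `σ𝔓` under automorphisms, before
(9.1): an automorphism `σ` permutes the primes above `p` and preserves exponents, so `(p)` is unramified at `σ𝔓` iff it is at `𝔓`);
G. Shimura, *Abelian Varieties with Complex Multiplication and Modular Functions* (1998) [Shimura1998], §13.1 Thm. 1 (pp. 97–99) (the ideal
decomposition `(N𝔓) = 𝔞 · 𝔞^ρ` of a Frobenius reading — §3 below is the one-line ideal arithmetic its consumers need).  Recorded: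
* §1 (any Dedekind domain `R`) `sup_asIdeal_eq_top_of_ne`, **`exists_mem_add_mem_eq_one_of_ne`** — for nonzero primes `v ≠ v′` there are
  `a ∈ 𝔭_v`, `b ∈ 𝔭_{v′}` with `a + b = 1`.
* §2 (a group `G` acting on a commutative ring ∕ Dedekind domain `B` by ring automorphisms) **`pointwise_smul_span_natCast`** — `g • (p) = (p)`
  for every natural number `p`; **`smul_asIdeal_pow_dvd_span_natCast_iff`** — `𝔭_{g•w}ⁿ ∣ (p) ↔ 𝔭_wⁿ ∣ (p)`; and the CM costumes for a CM number
  field `F` with complex conjugation `c = IsCMField.complexConj F` acting on `𝓞 F` and on its places: `complexConj_smul_span_natCast`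
  (`c • (p) = (p)`), `complexConj_smul_asIdeal_sq_dvd_span_natCast_iff` and **`not_sq_complexConj_smul_asIdeal_dvd_span_natCast`**
  («`𝔭_w² ∤ (p) ⇒ 𝔭_{c•w}² ∤ (p)`»: if `p` is unramified at `w` it is unramified at the conjugate place).
* §3 (`G` acting on a field `F` by ring automorphisms, hence on `𝓞 F`) **`natCast_mem_mul_asIdeal_mul_smul_asIdeal`** — if `𝔠 · 𝔭_w = 𝔞`,
  `(n) = 𝔞 · g•𝔞` and `𝔭_w ∣ 𝔞` then `n ∈ 𝔠 · (𝔭_w · 𝔭_{g•w})` (`𝔞 ≤ 𝔭_w` gives `g•𝔞 ≤ 𝔭_{g•w}`), and its `n = p^f` costume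
  `pow_natCast_mem_mul_asIdeal_mul_smul_asIdeal`.
Cell `hodgecm-mathlib`, «GO 500» half A (hLiu418), line L1, LA1-plan (g5) deal (P1) 2026-09-02T11:40:10Z «★-lift of one BY-COPY block»: these
statements are carried verbatim, each under its own name and proof, by four served `Cruxes/HLiu418/Lines` leaflets —
`F0_P6a_RoofKernelCount` (`not_sq_conj_dvd_span_of_not_sq_dvd_span`), `F0_P6a_RoofCwKernel` (`complexConj_smul_span_natCast`,
`not_sq_smul_dvd_span_natCast`), `F0_P6a_SpecOrgans` (`exists_mem_add_mem_eq_one_of_ne`), `F0_P6a_RoofFrobKernelLawAssembly`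
(`natCast_mem_mul_asIdeal_mul_smul_asIdeal`, `hq_of_norm_spec`) — and by their HOME drafts; later editions import this file instead.
`--supports stmt-HodgeConjecture-24832`, count-neutral.  HONEST LABEL: HC_CM is proved only modulo the cell's 2 remaining named inputs
(hLiu418 = stmt-HodgeConjecture-24832, h413 = stmt-HodgeConjecture-24833) until rung 0 closes; this file is elementary and discharges none of them.

ED. 2 (append-only; ED. 1's nine declarations byte-identical) — THE PAIR OF CONJUGATE PLACES `w ≠ g•w`, the second by-copy block of the same story
(LA1-plan (g5) (P1′) 2026-09-02T12:3xZ):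
* §4 (`G` on a Dedekind `B`) **`asIdeal_sup_smul_asIdeal_eq_top`** — `g•w ≠ w ⇒ 𝔭_w + 𝔭_{g•w} = (1)`; `smul_asIdeal_le_mul_sup_pow` —
  `𝔭_{g•w} ≤ 𝔭_w·𝔭_{g•w} + 𝔭_{g•w}ⁿ`; (any commutative ring) `span_sup_pow_eq_top` — `a ≡ 1 (P) ⇒ (a) + Pⁿ = (1)`; `sub_one_mem_pow_sup_span` — the bridge
  congruence `e ≡ 1 (𝔭^f), (q) = 𝔭^f 𝔟^f, 𝔭 + 𝔟 = (1) ⇒ e − 1 ∈ 𝔭ⁿ + (q)`.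
* §5 (any Dedekind `R`) `sup_pow_asIdeal_eq_of_mul_asIdeal_eq` (`𝔠·𝔭_w = 𝔞 ⇒ 𝔠 + 𝔭_uⁿ = 𝔞 + 𝔭_uⁿ` for `u ≠ w`), `pow_asIdeal_sup_mul_eq_top`,
  `pow_asIdeal_sup_asIdeal_mul_asIdeal_eq_top` (`𝔭_uⁿ + 𝔭_v^a 𝔭_{v′}^b = (1)` off `{v, v′}`).
* §6 (number fields) **`exists_mem_not_mem_mul_eq_natCast`** — a scalar `a ∈ 𝔭_w ∖ 𝔭_{w′}` with `a·a′ = N ≠ 0`; (`G` on any `B`)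
  `exists_mem_eq_smul_of_mem_pointwise_smul` — every element of `g • 𝔟` is `g • b`, `b ∈ 𝔟`; CM costumes `exists_mem_coe_eq_complexConj_of_mem_smul`,
  `conjRingEquiv_apply_apply` (`c(c y) = y` on `𝓞 F`), `exists_asIdeal_mul_map_conj_mul_eq_span` (`𝔭_w · c(𝔭_w) ∣ (p)` for `c•w ≠ w`, `p ∈ 𝔭_w`).
Tree copies retired at the carriers' next editions: `F0_P6a_StubFROBRoofMiddleDual` §1 (:70 :78 :93), `F0_P6a_RoofCwKernel` §0a (:66 :83), `F0_P6a_RoofWInstantiation`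
§1 (:91), `F0_P6a_RoofFrobKernelLawAssembly` §1 (:72–:95), `F0_P6a_KillEngine` §5b (:399), `F0_P6a_QuotientFibreEngineInputs` (:204).

## Mathlib / tree search

Mathlib: `Ideal.IsMaximal.coprime_of_ne`, `Ideal.isCoprime_iff_sup_eq`, `Ideal.isCoprime_iff_exists`, `Ideal.pointwise_smul_def`, `Ideal.map_span`,
`map_natCast`, `Ideal.pointwise_smul_le_pointwise_smul_iff`, `Ideal.le_of_dvd`, `Ideal.mul_mono_right`, `NumberField.IsCMField.complexConj`
(`F ≃ₐ[F⁺] F`, acting on `𝓞 F` through Mathlib's `MulSemiringAction G (𝓞 K)`); no Mathlib lemma names `g • Ideal.span {↑p}` or the conjugate-place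
unramifiedness transfer (`rg "span_natCast" Mathlib/RingTheory/Ideal` : no pointwise hit).  Tree: ★ `GaloisActionPlaces` (`smul_asIdeal_pow_dvd_smul_iff`,
`card_quotient_smul`), ★ `IdealClassCoprimeRepresentative.pointwise_smul_sup_eq_top_of_sup_span_natCast_eq_top` (carries `g • (p) = (p)` as an
inline `have`), ★ `IdealNormEquationSupportPin` (`complexConj_inv`, `complexConj_smul_complexConj_smul`, the `(n) = 𝔞 · c𝔞` exponent bookkeeping —
complementary: exponents there, membership ∕ divisibility here), ★ `AbelianSchemeOver.le_sq_sup_span_of_not_sq_dvd_span` (`RoofFlatComparisonLeg` §0: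
`P ≤ P² + (x)` at an unramified `P` — the companion of §2 in `F0_P6a_RoofCwKernel` §4, already ★, not restated), ★ `CMFieldGaloisPrimesOverSplit`
(same currency `c • w`).
-/

namespace Literature.NumberTheory.NumberFields

open NumberField IsDedekindDomain
open Literature.NumberTheory.Automorphic
open scoped Pointwise

/-! ### §1 Distinct nonzero primes of a Dedekind domain are comaximal -/

section Dedekind

variable {R : Type*} [CommRing R] [IsDedekindDomain R]

/-- **Distinct nonzero primes of a Dedekind domain are comaximal**: `𝔭_v + 𝔭_{v′} = (1)` for `v ≠ v′` (both are maximal).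
[cite: NeukirchANT1999, Ch. I §3 (3.6)] -/
theorem sup_asIdeal_eq_top_of_ne (v v' : HeightOneSpectrum R) (h : v ≠ v') : v.asIdeal ⊔ v'.asIdeal = ⊤ :=
  Ideal.IsMaximal.coprime_of_ne v.isMaximal v'.isMaximal fun h' => h (HeightOneSpectrum.ext h')

/-- **THE COPRIME SPLIT**: for distinct nonzero primes `v ≠ v′` of a Dedekind domain there are `a ∈ 𝔭_v`, `b ∈ 𝔭_{v′}` with `a + b = 1`
(distinct maximal ideals are comaximal; the two-ideal case of the Chinese remainder theorem). [cite: NeukirchANT1999, Ch. I §3 (3.6)] -/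
theorem exists_mem_add_mem_eq_one_of_ne (v v' : HeightOneSpectrum R) (h : v ≠ v') :
    ∃ a ∈ v.asIdeal, ∃ b ∈ v'.asIdeal, a + b = 1 :=
  Ideal.isCoprime_iff_exists.mp (Ideal.isCoprime_iff_sup_eq.mpr (sup_asIdeal_eq_top_of_ne v v' h))

end Dedekind

/-! ### §2 A ring automorphism fixes `(p)`; unramifiedness of `(p)` transports to the conjugate prime -/

section Pointwise

variable {B : Type*} [CommRing B] {G : Type*} [Group G] [MulSemiringAction G B]

/-- **`g • (p) = (p)`**: a ring automorphism fixes the natural number `p`, hence the principal ideal it generates.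
[cite: NeukirchANT1999, Ch. I §9 (conjugate ideals `σ𝔞` under automorphisms, before (9.1))] -/
theorem pointwise_smul_span_natCast (g : G) (p : ℕ) :
    g • Ideal.span {((p : ℕ) : B)} = Ideal.span {((p : ℕ) : B)} := by
  rw [Ideal.pointwise_smul_def, Ideal.map_span, Set.image_singleton, map_natCast]

variable [IsDedekindDomain B]

/-- **`𝔭_{g•w}ⁿ ∣ (p) ↔ 𝔭_wⁿ ∣ (p)`**: the exponent of a prime in `(p)` is invariant under ring automorphisms (★ `smul_asIdeal_pow_dvd_smul_iff`
at the `g`-fixed ideal `(p)`); with `n = 2`: `(p)` is unramified at `g • w` iff it is unramified at `w`.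
[cite: NeukirchANT1999, Ch. I §9 (conjugate ideals `σ𝔞` under automorphisms, before (9.1))] -/
theorem smul_asIdeal_pow_dvd_span_natCast_iff (g : G) (w : HeightOneSpectrum B) (p n : ℕ) :
    (g • w).asIdeal ^ n ∣ Ideal.span {((p : ℕ) : B)} ↔ w.asIdeal ^ n ∣ Ideal.span {((p : ℕ) : B)} := by
  nth_rewrite 1 [← pointwise_smul_span_natCast g p]
  exact HeightOneSpectrum.smul_asIdeal_pow_dvd_smul_iff g w _ n

end Pointwise

section CM

variable {F : Type*} [Field F] [NumberField F] [IsCMField F]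

/-- **Complex conjugation fixes the ideal `(p)` of `𝓞 F`** (`c(p) = p`; `c = IsCMField.complexConj F` acting on `𝓞 F`).
[cite: NeukirchANT1999, Ch. I §9 (conjugate ideals `σ𝔞` under automorphisms, before (9.1))] -/
theorem complexConj_smul_span_natCast (p : ℕ) :
    (IsCMField.complexConj F) • Ideal.span {((p : ℕ) : 𝓞 F)} = Ideal.span {((p : ℕ) : 𝓞 F)} :=
  pointwise_smul_span_natCast (IsCMField.complexConj F) p

/-- **`𝔭_{c•w}² ∣ (p) ↔ 𝔭_w² ∣ (p)`** for a finite place `w` of a CM field and its complex conjugate `c • w`.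
[cite: NeukirchANT1999, Ch. I §9 (conjugate ideals `σ𝔞` under automorphisms, before (9.1))] -/
theorem complexConj_smul_asIdeal_sq_dvd_span_natCast_iff (w : HeightOneSpectrum (𝓞 F)) (p : ℕ) :
    ((IsCMField.complexConj F) • w).asIdeal ^ 2 ∣ Ideal.span {((p : ℕ) : 𝓞 F)} ↔ w.asIdeal ^ 2 ∣ Ideal.span {((p : ℕ) : 𝓞 F)} :=
  smul_asIdeal_pow_dvd_span_natCast_iff (IsCMField.complexConj F) w p 2

/-- **`𝔭_w² ∤ (p) ⇒ 𝔭_{c•w}² ∤ (p)`**: if the rational prime `p` is unramified at the place `w` of the CM field `F` then it is unramified at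
the conjugate place `c • w` (`c` is an automorphism of `𝓞 F` fixing `(p)` with `c • 𝔭_w = 𝔭_{c•w}`).
[cite: NeukirchANT1999, Ch. I §9 (conjugate ideals `σ𝔞` under automorphisms, before (9.1))] -/
theorem not_sq_complexConj_smul_asIdeal_dvd_span_natCast (w : HeightOneSpectrum (𝓞 F)) (p : ℕ)
    (hunr : ¬ (w.asIdeal ^ 2 ∣ Ideal.span {((p : ℕ) : 𝓞 F)})) :
    ¬ (((IsCMField.complexConj F) • w).asIdeal ^ 2 ∣ Ideal.span {((p : ℕ) : 𝓞 F)}) :=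
  fun h => hunr ((complexConj_smul_asIdeal_sq_dvd_span_natCast_iff w p).mp h)

end CM

/-! ### §3 The norm-product membership `n ∈ 𝔠 · (𝔭_w · 𝔭_{g•w})` -/

section NormProduct

variable {F : Type*} [Field F] {G : Type*} [Group G] [MulSemiringAction G F]

/-- **`n ∈ 𝔠 · (𝔭_w · g•𝔭_w)`** whenever `𝔠 · 𝔭_w = 𝔞`, `(n) = 𝔞 · g•𝔞` and `𝔭_w ∣ 𝔞` (for a ring automorphism `g` of the field `F`, e.g. complex
conjugation of a CM field): `𝔞 ≤ 𝔭_w` gives `g•𝔞 ≤ g•𝔭_w = 𝔭_{g•w}`, so `(n) = 𝔞 · g•𝔞 ≤ 𝔞 · 𝔭_{g•w} = 𝔠 · 𝔭_w · 𝔭_{g•w}` — the one-line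
ideal arithmetic by which a Frobenius reading `(N𝔓) = 𝔞 · 𝔞^ρ` with `𝔭_w ∣ 𝔞` feeds a «killed by `𝔠 · 𝔭_w 𝔭_{w̄}`» clause.
[cite: Shimura1998, §13.1 Thm. 1 (pp. 97–99)] -/
theorem natCast_mem_mul_asIdeal_mul_smul_asIdeal (g : G) {𝔠 𝔞 : Ideal (𝓞 F)} {w : HeightOneSpectrum (𝓞 F)} {n : ℕ}
    (h𝔠 : 𝔠 * w.asIdeal = 𝔞) (hspec : Ideal.span {((n : ℕ) : 𝓞 F)} = 𝔞 * g • 𝔞) (hdiv : w.asIdeal ∣ 𝔞) :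
    ((n : ℕ) : 𝓞 F) ∈ 𝔠 * (w.asIdeal * (g • w).asIdeal) := by
  have hn : ((n : ℕ) : 𝓞 F) ∈ 𝔞 * g • 𝔞 := hspec ▸ Ideal.mem_span_singleton_self _
  have hle : g • 𝔞 ≤ g • w.asIdeal := Ideal.pointwise_smul_le_pointwise_smul_iff.2 (Ideal.le_of_dvd hdiv)
  have h : 𝔞 * g • 𝔞 ≤ 𝔠 * (w.asIdeal * (g • w).asIdeal) := by
    rw [← mul_assoc, h𝔠]
    exact Ideal.mul_mono_right hle
  exact h hn

/-- **`p^f ∈ 𝔠 · (𝔭_w · 𝔭_{g•w})`** — `natCast_mem_mul_asIdeal_mul_smul_asIdeal` after the norm value `𝔫 = p^f` (the shape in which a twist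
ideal `𝔞_γ` with `(𝔫_γ) = 𝔞_γ · c•𝔞_γ`, `𝔫_γ = p^f`, `𝔠 · 𝔭_w = 𝔞_γ`, `𝔭_w ∣ 𝔞_γ` is consumed). [cite: Shimura1998, §13.1 Thm. 1 (pp. 97–99)] -/
theorem pow_natCast_mem_mul_asIdeal_mul_smul_asIdeal (g : G) {𝔞γ 𝔠 : Ideal (𝓞 F)} {w : HeightOneSpectrum (𝓞 F)} {p f 𝔫γ : ℕ}
    (h𝔠 : 𝔠 * w.asIdeal = 𝔞γ) (hspec : Ideal.span {((𝔫γ : ℕ) : 𝓞 F)} = 𝔞γ * g • 𝔞γ) (hnorm : 𝔫γ = p ^ f) (hdiv : w.asIdeal ∣ 𝔞γ) :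
    ((p ^ f : ℕ) : 𝓞 F) ∈ 𝔠 * (w.asIdeal * (g • w).asIdeal) := by
  subst hnorm
  exact natCast_mem_mul_asIdeal_mul_smul_asIdeal g h𝔠 hspec hdiv

end NormProduct

/-! ## ED. 2 (append-only) — the pair of conjugate places `w ≠ g • w`: coprimality, CRT glue, scalars -/

/-! ### §4 Coprimality at a moved place; two CRT inequalities -/

section MovedPlace

variable {B : Type*} [CommRing B] [IsDedekindDomain B] {G : Type*} [Group G] [MulSemiringAction G B]

/-- **`𝔭_w + 𝔭_{g•w} = (1)` when `g • w ≠ w`** (two distinct maximal ideals of the Dedekind domain `B` are comaximal; for a CM field and `g = c` this is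
«`𝔭_w` and `𝔭_{w̄}` are coprime at a place not fixed by complex conjugation»). [cite: NeukirchANT1999, Ch. I §3 (3.6)] -/
theorem asIdeal_sup_smul_asIdeal_eq_top {g : G} {w : HeightOneSpectrum B} (hgw : g • w ≠ w) :
    w.asIdeal ⊔ (g • w).asIdeal = ⊤ :=
  sup_asIdeal_eq_top_of_ne w (g • w) (Ne.symm hgw)

/-- **`𝔭_{g•w} ≤ 𝔭_w · 𝔭_{g•w} + 𝔭_{g•w}ⁿ`** for every `n` when `g • w ≠ w` (`n = 0`: the right side is `(1)`; `n ≥ 1`: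
`𝔭_{g•w} = 𝔭_{g•w} · (𝔭_w + 𝔭_{g•w}^{n-1})` as `𝔭_w`, `𝔭_{g•w}` are comaximal). [cite: NeukirchANT1999, Ch. I §3 (3.6)] -/
theorem smul_asIdeal_le_mul_sup_pow {g : G} {w : HeightOneSpectrum B} (hgw : g • w ≠ w) (n : ℕ) :
    (g • w).asIdeal ≤ w.asIdeal * (g • w).asIdeal ⊔ (g • w).asIdeal ^ n := by
  cases n with
  | zero => simp
  | succ n =>
    have hcop : w.asIdeal ⊔ (g • w).asIdeal ^ n = ⊤ := Ideal.sup_pow_eq_top (asIdeal_sup_smul_asIdeal_eq_top hgw)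
    have h : (g • w).asIdeal * (w.asIdeal ⊔ (g • w).asIdeal ^ n) = w.asIdeal * (g • w).asIdeal ⊔ (g • w).asIdeal ^ (n + 1) := by
      rw [Ideal.mul_sup, mul_comm, ← pow_succ']
    rw [hcop, Ideal.mul_top] at h
    exact h.le

end MovedPlace

section CRT

variable {R : Type*} [CommRing R]

/-- **`(a) + Pⁿ = (1)` when `a ≡ 1 (mod P)`** (any commutative ring: `1 = a − (a − 1) ∈ (a) + P`, then raise `P` to the `n`-th power).
[cite: NeukirchANT1999, Ch. I §3 (3.6)] -/
theorem span_sup_pow_eq_top {P : Ideal R} {a : R} (ha : a - 1 ∈ P) (n : ℕ) : Ideal.span {a} ⊔ P ^ n = ⊤ := by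
  apply Ideal.sup_pow_eq_top
  rw [Ideal.eq_top_iff_one]
  have : (1 : R) = a + (-(a - 1)) := by ring
  rw [this]
  exact Submodule.add_mem_sup (Ideal.mem_span_singleton_self a) ((Ideal.neg_mem_iff _).2 ha)

/-- **THE BRIDGE CONGRUENCE**: if `e − 1 ∈ 𝔭^f`, `(q) = 𝔭^f · 𝔟^f` and `𝔭 + 𝔟 = (1)`, then `e − 1 ∈ 𝔭ⁿ + (q)` for EVERY `n` (`n ≤ f`: `𝔭^f ≤ 𝔭ⁿ`; `n > f`:
`𝔭^f = 𝔭^f · (𝔭^{n−f} + 𝔟^f) ≤ 𝔭ⁿ + (q)`). [cite: NeukirchANT1999, Ch. I §3 (3.6)] -/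
theorem sub_one_mem_pow_sup_span {𝔭 𝔟 : Ideal R} {f : ℕ} {e q : R} (he : e - 1 ∈ 𝔭 ^ f) (hq : Ideal.span {q} = 𝔭 ^ f * 𝔟 ^ f)
    (hcop : 𝔭 ⊔ 𝔟 = ⊤) (n : ℕ) : e - 1 ∈ 𝔭 ^ n ⊔ Ideal.span {q} := by
  by_cases hn : n ≤ f
  · exact Ideal.mem_sup_left (Ideal.pow_le_pow_right hn he)
  · have hle : 𝔭 ^ f ≤ 𝔭 ^ n ⊔ Ideal.span {q} := by
      have hcop' : 𝔭 ^ (n - f) ⊔ 𝔟 ^ f = ⊤ := Ideal.pow_sup_pow_eq_top hcop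
      calc 𝔭 ^ f = 𝔭 ^ f * (𝔭 ^ (n - f) ⊔ 𝔟 ^ f) := by rw [hcop', Ideal.mul_top]
        _ = 𝔭 ^ n ⊔ 𝔭 ^ f * 𝔟 ^ f := by rw [Ideal.mul_sup, ← pow_add, Nat.add_sub_cancel' (le_of_not_ge hn)]
        _ ≤ 𝔭 ^ n ⊔ Ideal.span {q} := by rw [hq]
    exact hle he

end CRT

/-! ### §5 Coprimality glue between powers and products of distinct primes of a Dedekind domain -/

section DedekindGlue

variable {R : Type*} [CommRing R] [IsDedekindDomain R]

/-- **`𝔠 · 𝔭_w = 𝔞 ⇒ 𝔠 + 𝔭_uⁿ = 𝔞 + 𝔭_uⁿ` for `u ≠ w`** (the co-ideal `𝔠` and `𝔞` have the same `u`-part off `w`; Mathlib `Ideal.sup_mul_eq_of_coprime_right`).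
[cite: NeukirchANT1999, Ch. I §3 (3.6)] -/
theorem sup_pow_asIdeal_eq_of_mul_asIdeal_eq {𝔠 𝔞 : Ideal R} {w u : HeightOneSpectrum R} (h : 𝔠 * w.asIdeal = 𝔞) (huw : u ≠ w) (n : ℕ) :
    𝔠 ⊔ u.asIdeal ^ n = 𝔞 ⊔ u.asIdeal ^ n := by
  rw [← h, sup_comm, sup_comm (a := 𝔠 * w.asIdeal)]
  exact (Ideal.sup_mul_eq_of_coprime_right (Ideal.pow_sup_eq_top (sup_asIdeal_eq_top_of_ne u w huw))).symm

/-- **`𝔭_uⁿ + 𝔭_v^a · 𝔭_{v′}^b = (1)` for `u ∉ {v, v′}`** (coprimality with each factor, then with the product). [cite: NeukirchANT1999, Ch. I §3 (3.6)] -/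
theorem pow_asIdeal_sup_mul_eq_top {u v v' : HeightOneSpectrum R} (huv : u ≠ v) (huv' : u ≠ v') (n a b : ℕ) :
    u.asIdeal ^ n ⊔ v.asIdeal ^ a * v'.asIdeal ^ b = ⊤ := by
  have hv : u.asIdeal ^ n ⊔ v.asIdeal ^ a = ⊤ := Ideal.pow_sup_pow_eq_top (sup_asIdeal_eq_top_of_ne u v huv)
  have hv' : u.asIdeal ^ n ⊔ v'.asIdeal ^ b = ⊤ := Ideal.pow_sup_pow_eq_top (sup_asIdeal_eq_top_of_ne u v' huv')
  rw [Ideal.sup_mul_eq_of_coprime_left hv]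
  exact hv'

/-- `𝔭_uⁿ + 𝔭_v · 𝔭_{v′} = (1)` for `u ∉ {v, v′}` (the exponents-one case). [cite: NeukirchANT1999, Ch. I §3 (3.6)] -/
theorem pow_asIdeal_sup_asIdeal_mul_asIdeal_eq_top {u v v' : HeightOneSpectrum R} (huv : u ≠ v) (huv' : u ≠ v') (n : ℕ) :
    u.asIdeal ^ n ⊔ v.asIdeal * v'.asIdeal = ⊤ := by
  simpa only [pow_one] using pow_asIdeal_sup_mul_eq_top huv huv' n 1 1

end DedekindGlue

/-! ### §6 Scalars at a pair of places; elements and images of conjugate ideals -/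

section Scalars

variable {F : Type*} [Field F] [NumberField F]

/-- **A SCALAR `a ∈ 𝔭_w ∖ 𝔭_{w′}` WITH `a · a′ = N ≠ 0`** for two distinct places `w ≠ w′` of a number field (`𝔭_w ⊄ 𝔭_{w′}` by maximality; `N := |N(a)|`, Mathlib
`Ideal.absNorm_mem`). [cite: NeukirchANT1999, Ch. I §3 (3.6)] -/
theorem exists_mem_not_mem_mul_eq_natCast (w w' : HeightOneSpectrum (𝓞 F)) (hww : w' ≠ w) :
    ∃ (a a' : 𝓞 F) (N : ℕ), N ≠ 0 ∧ a ∈ w.asIdeal ∧ a ∉ w'.asIdeal ∧ a * a' = N := by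
  have hne : ¬ w.asIdeal ≤ w'.asIdeal := by
    intro hle
    have := w.isMaximal.eq_of_le w'.isPrime.ne_top hle
    exact hww (HeightOneSpectrum.ext this.symm)
  obtain ⟨a, haw, haw'⟩ := SetLike.not_le_iff_exists.mp hne
  have ha0 : a ≠ 0 := by rintro rfl; exact haw' (Ideal.zero_mem _)
  have hN : Ideal.absNorm (Ideal.span {a}) ≠ 0 := by
    rw [Ne, Ideal.absNorm_eq_zero_iff, Ideal.span_singleton_eq_bot]; exact ha0
  have hmem : ((Ideal.absNorm (Ideal.span {a}) : ℕ) : 𝓞 F) ∈ Ideal.span {a} := Ideal.absNorm_mem _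
  obtain ⟨a', ha'⟩ := Ideal.mem_span_singleton'.mp hmem
  exact ⟨a, a', _, hN, haw, haw', by rw [mul_comm]; exact ha'⟩

end Scalars

section Conjugates

variable {B : Type*} [CommRing B] {G : Type*} [Group G] [MulSemiringAction G B]

/-- **Every element of `g • 𝔟` is `g • b` for some `b ∈ 𝔟`** (Mathlib's pointwise action of a ring automorphism on ideals is `Ideal.map` along it, and the map is onto).
[cite: NeukirchANT1999, Ch. I §9 (conjugate ideals `σ𝔞` under automorphisms, before (9.1))] -/
theorem exists_mem_eq_smul_of_mem_pointwise_smul (g : G) (𝔟 : Ideal B) : ∀ j ∈ g • 𝔟, ∃ b ∈ 𝔟, j = g • b := by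
  intro j hj
  rw [Ideal.pointwise_smul_def] at hj
  have hsurj : Function.Surjective (MulSemiringAction.toRingHom G B g) := fun y =>
    ⟨g⁻¹ • y, by rw [MulSemiringAction.toRingHom_apply, smul_inv_smul]⟩
  obtain ⟨b, hb, hbj⟩ := (Ideal.mem_map_iff_of_surjective _ hsurj).1 hj
  exact ⟨b, hb, by rw [← hbj, MulSemiringAction.toRingHom_apply]⟩

end Conjugates

section CMConjugates

variable {F : Type*} [Field F] [NumberField F] [IsCMField F]

/-- **Every element of the conjugate ideal `c • 𝔟` is the conjugate of an element of `𝔟`**: `j ∈ c • 𝔟 ⇒ ∃ b ∈ 𝔟, j = c(b)` in `F` (`c = IsCMField.complexConj F`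
acting on `𝓞 F`). [cite: NeukirchANT1999, Ch. I §9 (conjugate ideals `σ𝔞` under automorphisms, before (9.1))] -/
theorem exists_mem_coe_eq_complexConj_of_mem_smul (𝔟 : Ideal (𝓞 F)) :
    ∀ j ∈ (IsCMField.complexConj F) • 𝔟, ∃ b ∈ 𝔟, (j : F) = (IsCMField.complexConj F) (b : F) := by
  intro j hj
  obtain ⟨b, hb, rfl⟩ := exists_mem_eq_smul_of_mem_pointwise_smul (IsCMField.complexConj F) 𝔟 j hj
  exact ⟨b, hb, rfl⟩

/-- **`c(c y) = y` on `𝓞 F`** for `c := MulSemiringAction.toRingEquiv _ (𝓞 F) (IsCMField.complexConj F)` (complex conjugation is an involution; compared in `F`,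
Mathlib `IsCMField.complexConj_apply_apply`). [cite: NeukirchANT1999, Ch. I §9 (conjugate ideals `σ𝔞` under automorphisms, before (9.1))] -/
theorem conjRingEquiv_apply_apply (y : 𝓞 F) :
    MulSemiringAction.toRingEquiv _ (𝓞 F) (IsCMField.complexConj F) (MulSemiringAction.toRingEquiv _ (𝓞 F) (IsCMField.complexConj F) y) = y :=
  NumberField.RingOfIntegers.coe_injective (by
    change (IsCMField.complexConj F) ((IsCMField.complexConj F) (y : F)) = (y : F)
    exact IsCMField.complexConj_apply_apply F y)

omit [IsCMField F] in
/-- **`𝔭_w · c(𝔭_w) ∣ (p)`**: for an automorphism `c` of the CM∕number field over its maximal real subfield with `c • w ≠ w` and `p ∈ 𝔭_w` (so `p = c p ∈ 𝔭_{c•w}`: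
two distinct — coprime — primes divide `(p)`) there is `𝔡` with `𝔭_w · 𝔭_w.map c · 𝔡 = (p)` (`𝔭_w.map c = 𝔭_{c•w}`, ★ `HeightOneSpectrum.smul_asIdeal` + Mathlib
`Ideal.pointwise_smul_def`). [cite: NeukirchANT1999, Ch. I §3 (3.6)] -/
theorem exists_asIdeal_mul_map_conj_mul_eq_span {w : HeightOneSpectrum (𝓞 F)} {c : F ≃ₐ[↥(maximalRealSubfield F)] F} (hcw : c • w ≠ w)
    {p : ℕ} (hp : (p : 𝓞 F) ∈ w.asIdeal) :
    ∃ 𝔡 : Ideal (𝓞 F), w.asIdeal * w.asIdeal.map (MulSemiringAction.toRingEquiv _ (𝓞 F) c : 𝓞 F →+* 𝓞 F) * 𝔡 = Ideal.span {(p : 𝓞 F)} := by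
  have hmap : w.asIdeal.map (MulSemiringAction.toRingEquiv _ (𝓞 F) c : 𝓞 F →+* 𝓞 F) = (c • w).asIdeal := by
    rw [HeightOneSpectrum.smul_asIdeal, Ideal.pointwise_smul_def]; rfl
  have h1 : w.asIdeal ∣ Ideal.span {(p : 𝓞 F)} := Ideal.dvd_iff_le.2 ((Ideal.span_singleton_le_iff_mem _).2 hp)
  have hp' : (p : 𝓞 F) ∈ (c • w).asIdeal := by
    have hcp : c • (p : 𝓞 F) = p := map_natCast (MulSemiringAction.toRingHom _ (𝓞 F) c) p
    have := (HeightOneSpectrum.smul_mem_smul_asIdeal_iff c w (p : 𝓞 F)).2 hp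
    rwa [hcp] at this
  have h2 : (c • w).asIdeal ∣ Ideal.span {(p : 𝓞 F)} := Ideal.dvd_iff_le.2 ((Ideal.span_singleton_le_iff_mem _).2 hp')
  have hcop : IsCoprime w.asIdeal (c • w).asIdeal := Ideal.isCoprime_iff_sup_eq.2 (asIdeal_sup_smul_asIdeal_eq_top hcw)
  obtain ⟨𝔡, h𝔡⟩ := hcop.mul_dvd h1 h2
  exact ⟨𝔡, by rw [hmap]; exact h𝔡.symm⟩

end CMConjugates

end Literature.NumberTheory.NumberFields
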